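import Summits.CriticalPhenomena.PercolationContinuityZ3.Theorems.Transplant.Slab111VFastB
import Mathlib.Data.Nat.Bitwise
import HarnessLib

/-!
# The routing certificate for `ShapedLinkage 3 (Slab111.hexShadow k)`, II: the SEARCH (executable; evaluated by the kernel, never trusted)

builds on p205010 (kernel theorem, internal audit signed; external expert review pending) — NOT used in this file.  Lane `prim-bschramm`, seat
`prim-bschramm-p2` (gen 35; class C1b; memo `HOME/bschramm/P2-LATTICES.md` §129); helper file (`--supports stmt-CriticalPhenomena-4575 --as helper`).
Nothing in this file carries mathematical content: it is a heuristic that PROPOSES plans («Slab111VPlan»); every proposed plan is re-checked by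
`PlanD.check` and only the checker has a soundness proof («Slab111VSoundA»–«Slab111VSwapPlan»).  The search mirrors the seat's Python prototype (`work/elev/search2.py`):
vertex sets of the relative model are `ℕ` bitmasks (`vid`: column index `× 16 +` level slot, so that the six film steps are shifts by fixed amounts and
a breadth-first search is a dozen GMP operations per layer — `decide` runs hundreds of searches per second), attachments are enumerated per terminal
column, diamonds per level window, and the cores are shortest paths avoiding the other terminals' ride regions.
* §1 bitmask geometry (`vid`, `vdec`, `expand`, `bfsPath`), column/vertex masks of a block type;
* §2 attachments (`attsOf`), terminal options with region masks (`Opt`), diamonds;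
The searches themselves (`coresAB`, `completeT`, `pairSearch`, `searchFree`, `searchAnchored`, `searchStack`) are «Slab111VSearchB»; the need list,
bundles and the certificate test are «Slab111VBundle».
-/

namespace Summit.CriticalPhenomena.PercolationContinuityZ3.Theorems.Transplant

namespace Slab111

namespace Srch

/-! ## §1 Bitmask geometry -/

/-- Lowest relative level of the search window (`λ ∈ [−6, 8]`, slots `0 … 14` of width-`16` level fields). [folklore] -/
def LAMLO : ℤ := -6
/-- Highest relative level of the search window. [folklore] -/
def LAMHI : ℤ := 8

/-- Column index `(a+3)·8 + (b+3)` of a relative column in `[−3,3]²`. [folklore] -/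
def cidx (q : Col) : ℕ := ((q.1 + 3) * 8 + (q.2 + 3)).toNat
/-- Vertex id: column index `× 16 +` level slot. [folklore] -/
def vid (p : MV) : ℕ := cidx p.1 * 16 + (p.2 - LAMLO).toNat
/-- Decode a vertex id. [folklore] -/
def vdec (i : ℕ) : MV := ((((i / 16 / 8 : ℕ) : ℤ) - 3, ((i / 16 % 8 : ℕ) : ℤ) - 3), ((i % 16 : ℕ) : ℤ) + LAMLO)
/-- Single bit. [folklore] -/
def bit (i : ℕ) : ℕ := 1 <<< i
/-- Lowest set bit as a mask. [folklore] -/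
def lowbit (m : ℕ) : ℕ := m ^^^ (m &&& (m - 1))
/-- Index of the highest set bit of `m < 2^1024` by binary search (kernel-friendly: `Nat.log2` is not GMP-accelerated in the kernel). [folklore] -/
def hiIdx (m : ℕ) : ℕ := [512, 256, 128, 64, 32, 16, 8, 4, 2, 1].foldl (fun acc d => if (m >>> (acc + d)) != 0 then acc + d else acc) 0
/-- Index of the lowest set bit. [folklore] -/
def lowidx (m : ℕ) : ℕ := hiIdx (lowbit m)
/-- Mask of a list of vertices. [folklore] -/
def maskOf (l : List MV) : ℕ := l.foldl (fun acc p => acc ||| bit (vid p)) 0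
/-- `m` without the bits of `r`. [folklore] -/
def minus (m r : ℕ) : ℕ := m ^^^ (m &&& r)
/-- Bit test. [folklore] -/
def hasBit (m : ℕ) (i : ℕ) : Bool := m.testBit i

/-- One film step in all six directions, on masks: `(1,0),+1 ↦ +129`, `(0,−1),+1 ↦ −15`, `(−1,1),+1 ↦ −111` and the reverses. [folklore] -/
def expand (m : ℕ) : ℕ := (m <<< 129) ||| (m >>> 15) ||| (m >>> 111) ||| (m >>> 129) ||| (m <<< 15) ||| (m <<< 111)

/-- All relative columns of the radius-3 hexagon, inner columns first. [folklore] -/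
def hexCols : List Col :=
  [(0,0), (-1,0), (-1,1), (0,-1), (0,1), (1,-1), (1,0), (-2,0), (-2,1), (-2,2), (-1,-1), (-1,2), (0,-2), (0,2), (1,-2), (1,1), (2,-2), (2,-1), (2,0), (-3,0), (-3,1), (-3,2), (-3,3), (-2,-1), (-2,3), (-1,-2), (-1,3), (0,-3), (0,3), (1,-3), (1,2), (2,-3), (2,1), (3,-3), (3,-2), (3,-1), (3,0)]

/-- The replication constant `Σ 2^(16·ci)` over the column indices. [folklore] -/
def REP : ℕ := (List.range 56).foldl (fun acc ci => acc ||| bit (16 * ci)) 0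
/-- Mask of all slots of the relative levels in `[lo, hi]`, over every column index. [folklore] -/
def bandMask (lo hi : ℤ) : ℕ :=
  ((List.range 15).foldl (fun acc (j : ℕ) => let lam := LAMLO + (j : ℤ); if lo ≤ lam ∧ lam ≤ hi then acc ||| bit j else acc) 0) * REP
/-- Mask of the class-valid vertices over the columns satisfying `ok` (whole level window). [folklore] -/
def vmaskAll (ok : Col → Bool) : ℕ :=
  hexCols.foldl (fun acc q => if ok q then
    (List.range 15).foldl (fun acc (j : ℕ) => let lam := LAMLO + (j : ℤ)
      if (lam - lvlC q) % 3 = 0 then acc ||| bit (vid (q, lam)) else acc) acc else acc) 0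

/-- Breadth-first layers from `cur` inside `free` until `target` is met (fuel-bounded); layers returned last-first, `[]` if unreachable. [folklore] -/
def bfsLayers (free target : ℕ) : ℕ → ℕ → ℕ → List ℕ → List ℕ
  | 0, _, _, _ => []
  | fuel + 1, cur, vis, acc =>
    if cur &&& target != 0 then cur :: acc
    else
      let nxt := (expand cur) &&& minus free vis
      if nxt == 0 then [] else bfsLayers free target fuel nxt (vis ||| nxt) (cur :: acc)

/-- Flood fill: all vertices reachable from `cur` inside `free` in at most `fuel` steps (as a mask, including the start). [folklore] -/
def flood (free : ℕ) : ℕ → ℕ → ℕ → ℕ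
  | 0, _, vis => vis
  | fuel + 1, cur, vis =>
    let nxt := (expand cur) &&& minus free vis
    if nxt == 0 then vis else flood free fuel nxt (vis ||| nxt)

/-- Pick a set bit: the lowest (`hi = false`) or the highest. [folklore] -/
def pick (hi : Bool) (m : ℕ) : ℕ := if hi then hiIdx m else lowidx m

/-- A complete binary tree of the decoded vertex ids `off … off + 2^depth − 1` (leaves are shared terms: the kernel memoises every test on them). [folklore] -/
inductive VT where
  /-- leaf: a decoded vertex -/
  | leaf : MV → VT
  /-- node: lower and upper half -/
  | node : VT → VT → VT

/-- Build the tree of depth `d` starting at id `off`. [folklore] -/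
def VT.mk : ℕ → ℕ → VT
  | 0, off => VT.leaf (vdec off)
  | d + 1, off => VT.node (VT.mk d off) (VT.mk d (off + 2 ^ d))

/-- Look an id up (bits `d−1 … 0` of `i`). [folklore] -/
def VT.get : VT → ℕ → ℕ → MV
  | VT.leaf v, _, _ => v
  | VT.node l r, d + 1, i => if hasBit i d then r.get d i else l.get d i
  | VT.node l _, 0, i => l.get 0 i

/-- The tree of all vertex ids `< 1024`. [folklore] -/
def vtree : VT := VT.mk 10 0

/-- Decode a vertex id through the shared tree. [folklore] -/
def vget (i : ℕ) : MV := vtree.get 10 i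

/-- Canonical (shared) term for a model vertex: every vertex the search hands to the checker goes through the tree, so that the kernel evaluates
each per-vertex test once per context. [folklore] -/
def canon (v : MV) : MV := vget (vid v)

/-- Walk back through the layers from a target vertex (tie-break `hi`). [folklore] -/
def backtrack (hi : Bool) (target : ℕ) : List ℕ → List ℕ
  | [] => []
  | last :: rest =>
    let rec go (t : ℕ) : List ℕ → List ℕ → List ℕ
      | [], acc => t :: acc
      | l :: ls, acc => go (pick hi (l &&& expand (bit t))) ls (t :: acc)
    go (pick hi (last &&& target)) rest []

/-- **Shortest path** (vertex list, source first) from `src` to the first vertex of `target` reachable inside `free` in at most `maxlen` steps;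
`hi` selects the tie-break among shortest paths. [folklore] -/
def bfsPathV (hi : Bool) (free : ℕ) (src : MV) (target : ℕ) (maxlen : ℕ) : Option (List MV) :=
  match backtrack hi target (bfsLayers free target (maxlen + 1) (bit (vid src)) (bit (vid src)) []) with
  | [] => none
  | l => some (l.map vget)

/-- Shortest path with the default tie-break. [folklore] -/
def bfsPath (free : ℕ) (src : MV) (target : ℕ) (maxlen : ℕ) : Option (List MV) := bfsPathV false free src target maxlen

/-! ## §2 Search context, attachments, options, diamonds -/

/-- Search context of a block type and residue pair: the checking context plus precomputed masks and rhombi. [folklore] -/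
structure SCtx where
  /-- checking context in its fast (table) form -/
  T : CtxT
  /-- column mask of the rerouting columns -/
  mR : ℕ
  /-- column mask of the cleared columns -/
  mW : ℕ
  /-- class-valid vertices of all hexagon columns -/
  vA : ℕ
  /-- class-valid vertices over rerouting columns -/
  vR : ℕ
  /-- class-valid vertices over cleared columns -/
  vW : ℕ
  /-- all rhombi over rerouting columns, central ones first -/
  dias : List (MV × MV × MV × MV)

/-- The three up-directions. [folklore] -/
def ups : List Col := [(1,0), (0,-1), (-1,1)]

/-- Rhombi `(bot, m1, m2, top)` over columns satisfying `ok`, bottom level in the window, central ones first (by `tn bot + tn top`, then level). [folklore] -/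
def diamondsAll (ok : Col → Bool) : List (MV × MV × MV × MV) :=
  let lams : List ℤ := [0, 1, -1, 2, -2, 3, -3, 4, -4, 5, -5, 6, -6]
  let all := lams.flatMap fun lam => hexCols.flatMap fun q =>
    if (lam - lvlC q) % 3 != 0 || !ok q then [] else
    [(0,1), (1,0), (0,2), (2,0), (1,2), (2,1)].filterMap fun ij =>
      let u := ups.getD ij.1 (0,0); let u' := ups.getD ij.2 (0,0)
      let c1 : Col := (q.1 + u.1, q.2 + u.2); let c2 : Col := (q.1 + u'.1, q.2 + u'.2); let ct : Col := (q.1 + u.1 + u'.1, q.2 + u.2 + u'.2)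
      if ok c1 && ok c2 && ok ct then
        some ((tnZ q + tnZ ct).toNat, canon (q, lam), canon (c1, lam + 1), canon (c2, lam + 1), canon (ct, lam + 2)) else none
  (List.range 7).flatMap fun s => all.filterMap fun d => if d.1 == s then some d.2 else none

/-- Build the search context. [folklore] -/
def SCtx.of (C : Ctx) : SCtx :=
  let T := CtxT.of C
  let mR := hexCols.foldl (fun acc q => if colRWT T q then acc ||| bit (cidx q) else acc) 0
  let mW := hexCols.foldl (fun acc q => if colWT T q then acc ||| bit (cidx q) else acc) 0
  let okR (q : Col) : Bool := hasBit mR (cidx q)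
  let okW (q : Col) : Bool := hasBit mW (cidx q)
  ⟨T, mR, mW, vmaskAll (fun q => decide (tnZ q ≤ 3)), vmaskAll okR, vmaskAll okW, diamondsAll okR⟩

/-- The checking context. [folklore] -/
def SCtx.C (S : SCtx) : Ctx := S.T.C
/-- Usable columns (rerouted piece). [folklore] -/
def SCtx.okR (S : SCtx) (q : Col) : Bool := hasBit S.mR (cidx q)
/-- Usable columns (branch). [folklore] -/
def SCtx.okW (S : SCtx) (q : Col) : Bool := hasBit S.mW (cidx q)
/-- All class-valid vertices of a column in the window. [folklore] -/
def SCtx.colV (S : SCtx) (q : Col) : ℕ := S.vA &&& (65535 <<< (16 * cidx q))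
/-- Mask of an envelope. [folklore] -/
def envMask : Env → ℕ
  | Env.any => bandMask LAMLO LAMHI
  | Env.ge fl => bandMask fl LAMHI
  | Env.le ce => bandMask LAMLO ce

/-- The six unit vectors in counter-clockwise order. [folklore] -/
def ring6 : List Col := [(1,0), (0,1), (-1,1), (-1,0), (0,-1), (1,-1)]

/-- Face data from three columns (sorted by class). [folklore] -/
def mkFace (p q r : Col) : FaceD :=
  let byCls (c : ℤ) : Col := if lvlC p % 3 = c then p else if lvlC q % 3 = c then q else r
  ⟨byCls 0, byCls 1, byCls 2⟩

/-- Faces containing `q` whose columns all satisfy `ok`. [folklore] -/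
def facesAt (ok : Col → Bool) (q : Col) : List FaceD :=
  (List.range 6).filterMap fun i =>
    let r := ring6.getD i (0,0); let r' := ring6.getD ((i + 1) % 6) (0,0)
    let p := (q.1 + r.1, q.2 + r.2); let p' := (q.1 + r'.1, q.2 + r'.2)
    if ok q && ok p && ok p' then some (mkFace q p p') else none

/-- **Attachments of a terminal column**: plain faces first, then faces adjacent by one extra step. [folklore] -/
def attsOf (ok : Col → Bool) (c : Col) : List AttD :=
  (facesAt ok c).map (fun F => ⟨F, c, 0⟩) ++
  (ups.flatMap fun u =>
    let fd : Col := (c.1 - u.1, c.2 - u.2); let fu : Col := (c.1 + u.1, c.2 + u.2)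
    ((facesAt ok fd).filter (fun F => !([F.f0, F.f1, F.f2].contains c))).map (fun F => (⟨F, c, -1⟩ : AttD)) ++
    ((facesAt ok fu).filter (fun F => !([F.f0, F.f1, F.f2].contains c))).map (fun F => (⟨F, c, 1⟩ : AttD)))

/-- A terminal option with its region mask, port-target mask and footprint-column mask. [folklore] -/
structure Opt where
  /-- the option -/
  t : TermD
  /-- blocked region (footprint columns × envelope) -/
  reg : ℕ
  /-- admissible ports (face columns × envelope; the exact vertex) -/
  port : ℕ
  /-- footprint columns (rides; `0` for an exact option) -/
  fm : ℕ

/-- Ride option. [folklore] -/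
def mkRide (S : SCtx) (a : AttD) (e : Env) : Opt :=
  let em := envMask e
  let fm := S.colV a.F.f0 ||| S.colV a.F.f1 ||| S.colV a.F.f2
  ⟨TermD.ride a e, (fm ||| S.colV a.c) &&& em, fm &&& em, bit (cidx a.c) ||| bit (cidx a.F.f0) ||| bit (cidx a.F.f1) ||| bit (cidx a.F.f2)⟩

/-- Exact option (canonical vertex term). [folklore] -/
def mkExact (v : MV) : Opt := ⟨TermD.exact (canon v), 0, bit (vid v), 0⟩

/-- Footprints of two options overlap (rides only; a mask test). [folklore] -/
def Opt.clash (o o' : Opt) : Bool := o.fm &&& o'.fm != 0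

end Srch

end Slab111

end Summit.CriticalPhenomena.PercolationContinuityZ3.Theorems.Transplant
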